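import Literature.MathematicalPhysics.QuantumLattice.StabilitySqrtChainProofs
import Literature.MathematicalPhysics.QuantumLattice.StabilitySmoothingTailsProofs
import Literature.MathematicalPhysics.QuantumLattice.StabilityTwirlPiecesProofs
import HarnessLib

/-!
# `michalakis_zwolak` from an `O(ε)` norm estimate and `ε`-free tail estimates

Top-down layer (seat B) of the formalisation of the Michalakis–Zwolak stability theorem
(hubbard.S19, `Literature.MathematicalPhysics.QuantumLattice.michalakis_zwolak`). The reduction
`michalakis_zwolak_of_locality_core_sqrt` asks, per term, for radius-indexed Hermitian pieces on
balls with envelopes `√|ε| B_p/(ℓ+1)^p` (rotated `Φ`-terms) and `B_p/(ℓ+1)^p` (rotated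
`V`-terms). Here the pieces are manufactured once and for all from **twirl tails**
(`exists_ball_pieces_of_twirl_errors`), and the `√|ε|` is produced by the elementary
`min(εa, b_{2p}/(ℓ+1)^{2p}) ≤ √ε √(a b_{2p})/(ℓ+1)^p`, so that the remaining hypothesis of
`michalakis_zwolak_of_tail_core` consists of pure estimates on the two families
`F_A(Z) = U(s)ᴴ 𝓕^s(Φ Z) U(s) − 𝓕⁰(Φ Z)` and `F_B(Z) = U(s)ᴴ 𝓕^s(V Z) U(s)`
(`𝓕^s(O) = ∫ w(t) τ_t^{H_s}(O) dt`, `H_s = Σ Φ + s ε Σ V`, `U` the spectral flow handed over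
through its defining data): for every centre `x` with `Z ⊆ b_x(r₀)` (resp. `b_x(r)`),
an `O(ε)` NORM bound `‖F_A(Z)‖ ≤ |ε| C₀` (MZ13 Lemma 1 (v) and Lemma 2: `X⁽¹⁾`, `X⁽²⁾` are
`O(sJ)`, arXiv:1109.1588 pp. 9, 12) and `ε`-FREE tails
`‖F_A(Z) − 𝔼_{b_x(r₀+ℓ)ᶜ}(F_A(Z))‖ ≤ C_p/(ℓ+1)^p`, `‖F_B(Z) − 𝔼_{b_x(r+ℓ)ᶜ}(F_B(Z))‖ ≤ C_p/(ℓ+1)^p`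
for all `ℓ`, `p` (MZ13 Lemma 1 (iv), Lemma 2), with `C_p ≥ 0` depending on the data, `w` and `W`
only. No definitions, no named facts (theorems only).
-/

noncomputable section

open Matrix Finset Module MeasureTheory Complex
open scoped InnerProductSpace ComplexOrder Matrix.Norms.L2Operator SchwartzMap

namespace Literature.MathematicalPhysics.QuantumLattice

open Literature.Probability.LatticeModels

/-! ### Helpers -/

section Helpers

variable {d L : ℕ} [NeZero L] {κ : Type*} [Fintype κ] [DecidableEq κ] {q : ℕ}

/-- `min(a, b) ≤ √(ab)`: if `0 ≤ x ≤ a` and `x ≤ b` then `x ≤ √(a b)`. [folklore] -/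
theorem le_sqrt_mul_of_le_of_le {x a b : ℝ} (hx : 0 ≤ x) (ha : x ≤ a) (hb : x ≤ b) :
    x ≤ Real.sqrt (a * b) :=
  calc x = Real.sqrt (x * x) := (Real.sqrt_mul_self hx).symm
    _ ≤ Real.sqrt (a * b) := Real.sqrt_le_sqrt (mul_le_mul ha hb hx (hx.trans ha))

/-- `√(K/(ℓ+1)^{2p}) = √K/(ℓ+1)^p`. [folklore] -/
theorem sqrt_div_pow_two_mul {K : ℝ} (hK : 0 ≤ K) (ℓ p : ℕ) :
    Real.sqrt (K / ((ℓ : ℝ) + 1) ^ (2 * p)) = Real.sqrt K / ((ℓ : ℝ) + 1) ^ p := by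
  rw [Real.sqrt_div hK, pow_mul', Real.sqrt_sq (by positivity)]

/-- Conjugating by a unitary does not increase the operator norm: `‖U⋆ G U‖ ≤ ‖G‖`. [folklore] -/
theorem norm_star_mul_mul_le_of_mem_unitary {n : Type*} [Fintype n] [DecidableEq n]
    {U : Matrix n n ℂ} (hU : U ∈ unitary (Matrix n n ℂ)) (G : Matrix n n ℂ) :
    ‖star U * G * U‖ ≤ ‖G‖ := by
  rcases subsingleton_or_nontrivial (Matrix n n ℂ) with hs | hs
  · rw [Subsingleton.elim (star U * G * U) G]
  · have h1 : ‖U‖ = 1 := CStarRing.norm_of_mem_unitary hU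
    have h2 : ‖star U‖ = 1 := by rw [norm_star, h1]
    calc ‖star U * G * U‖ ≤ ‖star U * G‖ * ‖U‖ := norm_mul_le _ _
      _ ≤ ‖star U‖ * ‖G‖ * ‖U‖ := by gcongr; exact norm_mul_le _ _
      _ = ‖G‖ := by rw [h1, h2, one_mul, mul_one]

/-- Conjugating a Hermitian matrix by a unitary (written with `star`) gives a Hermitian matrix.
[folklore] -/
theorem isHermitian_star_mul_mul {n : Type*} [Fintype n] {U G : Matrix n n ℂ}
    (hG : G.IsHermitian) : (star U * G * U).IsHermitian := by
  rw [star_eq_conjTranspose]; exact isHermitian_conjTranspose_mul_mul U hG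

/-- **Ball pieces with power-law envelopes from power-law twirl tails.** Let `F` be Hermitian,
`x` a centre and `r₀` a base radius, with `‖F‖ ≤ a C₀` and tails
`‖F − 𝔼_{b_x(r₀+ℓ)ᶜ}(F)‖ ≤ a C_p/(ℓ+1)^p` for all `ℓ`, `p` (`a, C_p ≥ 0`). Then `F = Σ_{i ≤ L} A i`
with `A i` Hermitian, supported in `cellBall x i`, and
`‖A i‖ ≤ a (C₀ (r₀+1)^p + 2 C_p (r₀+2)^p)/(i+1)^p` for all `i`, `p` (pieces from
`exists_ball_pieces_of_twirl_errors` at the base radius `min r₀ L`; for `r₀ > L` all tails vanish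
since the balls are the whole torus). [cite: MichalakisZwolakCMP2013, §5.1 Lemma 1 (iv) (arXiv:1109.1588 pp. 9–10)] -/
theorem exists_ball_pieces_of_pow_tails (x : TorusSite d L) (r₀ : ℕ)
    {F : Op (TorusSite d L × κ) q} (hF : F.IsHermitian) {a : ℝ} (ha : 0 ≤ a) {C : ℕ → ℝ}
    (hC : ∀ p, 0 ≤ C p) (hF0 : ‖F‖ ≤ a * C 0)
    (htail : ∀ ℓ p : ℕ, ‖F - twirl (cellBall x (r₀ + ℓ) : Finset (TorusSite d L × κ))ᶜ F‖ ≤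
      a * (C p / ((ℓ : ℝ) + 1) ^ p)) :
    ∃ A : ℕ → Op (TorusSite d L × κ) q,
      (∑ i ∈ range (L + 1), A i = F) ∧ (∀ i, (A i).IsHermitian) ∧
      (∀ i, IsSupportedOn (A i) (cellBall x i)) ∧
      ∀ i p : ℕ, ‖A i‖ ≤
        a * ((C 0 * ((r₀ : ℝ) + 1) ^ p + 2 * C p * ((r₀ : ℝ) + 2) ^ p) / ((i : ℝ) + 1) ^ p) := by
  set r' : ℕ := min r₀ L with hr'
  have hr'L : r' ≤ L := min_le_right _ _
  have hr'r : r' ≤ r₀ := min_le_left _ _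
  -- tails at the base radius `r'`
  have htail' : ∀ ℓ p : ℕ, ‖F - twirl (cellBall x (r' + ℓ) : Finset (TorusSite d L × κ))ᶜ F‖ ≤
      a * (C p / ((ℓ : ℝ) + 1) ^ p) := by
    intro ℓ p
    rcases le_or_gt r₀ L with h | h
    · rw [hr', min_eq_left h]; exact htail ℓ p
    · have hr'eq : r' = L := by rw [hr', min_eq_right h.le]
      rw [hr'eq, cellBall_eq_univ_of_half_le x ((Nat.div_le_self L 2).trans (Nat.le_add_right L ℓ)),
        compl_univ, twirl_empty, sub_self, norm_zero]
      exact mul_nonneg ha (div_nonneg (hC p) (by positivity))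
  obtain ⟨A, hsum, hh, hs, hlt, hbase, hstep⟩ := exists_ball_pieces_of_twirl_errors x hr'L hF
    (err := fun ℓ => ‖F - twirl (cellBall x (r' + ℓ) : Finset (TorusSite d L × κ))ᶜ F‖)
    (fun ℓ => le_rfl)
  refine ⟨A, hsum, hh, hs, fun i p => ?_⟩
  have hi1 : (0 : ℝ) < (i : ℝ) + 1 := by positivity
  have hK0 : 0 ≤ C 0 * ((r₀ : ℝ) + 1) ^ p + 2 * C p * ((r₀ : ℝ) + 2) ^ p := by
    have := hC 0; have := hC p; positivity
  rcases lt_trichotomy i r' with h | h | h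
  · -- below the base radius the pieces vanish
    rw [hlt i h, norm_zero]; positivity
  · -- the base piece
    subst h
    rw [← mul_div_assoc, le_div_iff₀ (pow_pos hi1 p)]
    have h1 : ((min r₀ L : ℕ) : ℝ) + 1 ≤ (r₀ : ℝ) + 1 := by
      have : ((min r₀ L : ℕ) : ℝ) ≤ r₀ := by exact_mod_cast hr'r
      linarith
    have h2 : (((min r₀ L : ℕ) : ℝ) + 1) ^ p ≤ ((r₀ : ℝ) + 1) ^ p :=
      pow_le_pow_left₀ (by positivity) h1 p
    calc ‖A (min r₀ L)‖ * ((((min r₀ L : ℕ) : ℝ)) + 1) ^ p ≤ a * C 0 * ((r₀ : ℝ) + 1) ^ p :=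
          mul_le_mul (hbase.trans hF0) h2 (by positivity) (mul_nonneg ha (hC 0))
      _ ≤ a * (C 0 * ((r₀ : ℝ) + 1) ^ p + 2 * C p * ((r₀ : ℝ) + 2) ^ p) := by
          have := hC p
          have : 0 ≤ a * (2 * C p * ((r₀ : ℝ) + 2) ^ p) := by positivity
          nlinarith
  · -- the telescoping pieces `i = r' + ℓ + 1`
    obtain ⟨ℓ, rfl⟩ : ∃ ℓ, i = r' + ℓ + 1 := ⟨i - r' - 1, by omega⟩
    have hℓ1 : (0 : ℝ) < (ℓ : ℝ) + 1 := by positivity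
    have e1 := htail' (ℓ + 1) p
    have e0 := htail' ℓ p
    have hsum2 : ‖A (r' + ℓ + 1)‖ ≤ 2 * (a * (C p / ((ℓ : ℝ) + 1) ^ p)) := by
      refine (hstep ℓ).trans ?_
      have hmono : a * (C p / (((ℓ + 1 : ℕ) : ℝ) + 1) ^ p) ≤ a * (C p / ((ℓ : ℝ) + 1) ^ p) := by
        refine mul_le_mul_of_nonneg_left (div_le_div_of_nonneg_left (hC p) (pow_pos hℓ1 p)
          (pow_le_pow_left₀ hℓ1.le (by push_cast; linarith) p)) ha
      linarith [e1.trans hmono, e0]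
    refine hsum2.trans ?_
    -- `(r' + ℓ + 2) ≤ (r₀ + 2)(ℓ + 1)`
    have hkey : ((r' + ℓ + 1 : ℕ) : ℝ) + 1 ≤ ((r₀ : ℝ) + 2) * ((ℓ : ℝ) + 1) := by
      have h1 : ((r' : ℕ) : ℝ) ≤ r₀ := by exact_mod_cast hr'r
      push_cast
      nlinarith
    have hpow : (((r' + ℓ + 1 : ℕ) : ℝ) + 1) ^ p ≤ ((r₀ : ℝ) + 2) ^ p * ((ℓ : ℝ) + 1) ^ p := by
      rw [← mul_pow]; exact pow_le_pow_left₀ (by positivity) hkey p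
    have h3 : C p / ((ℓ : ℝ) + 1) ^ p ≤
        C p * ((r₀ : ℝ) + 2) ^ p / (((r' + ℓ + 1 : ℕ) : ℝ) + 1) ^ p := by
      rw [div_le_div_iff₀ (pow_pos hℓ1 p) (pow_pos hi1 p)]
      calc C p * ((((r' + ℓ + 1 : ℕ) : ℝ)) + 1) ^ p ≤ C p * (((r₀ : ℝ) + 2) ^ p * ((ℓ : ℝ) + 1) ^ p) :=
            mul_le_mul_of_nonneg_left hpow (hC p)
        _ = C p * ((r₀ : ℝ) + 2) ^ p * ((ℓ : ℝ) + 1) ^ p := by ring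
    have hC0p : 0 ≤ C 0 * ((r₀ : ℝ) + 1) ^ p := by have := hC 0; positivity
    calc 2 * (a * (C p / ((ℓ : ℝ) + 1) ^ p))
        ≤ 2 * (a * (C p * ((r₀ : ℝ) + 2) ^ p / (((r' + ℓ + 1 : ℕ) : ℝ) + 1) ^ p)) := by gcongr
      _ = a * ((2 * C p * ((r₀ : ℝ) + 2) ^ p) / (((r' + ℓ + 1 : ℕ) : ℝ) + 1) ^ p) := by ring
      _ ≤ a * ((C 0 * ((r₀ : ℝ) + 1) ^ p + 2 * C p * ((r₀ : ℝ) + 2) ^ p) /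
            (((r' + ℓ + 1 : ℕ) : ℝ) + 1) ^ p) :=
          mul_le_mul_of_nonneg_left (div_le_div_of_nonneg_right (by linarith) (by positivity)) ha

/-- **The `√ε` trick for tails**: if `‖F‖ ≤ ε₀ C₀` (`0 ≤ ε₀ ≤ 1`) and
`‖F − 𝔼_{b_x(R+ℓ)ᶜ}(F)‖ ≤ C_{2p}/(ℓ+1)^{2p}` for all `ℓ, p` (`C_p ≥ 0`), then with
`C'_p = C₀ + √(2 C₀ C_{2p})`: `‖F‖ ≤ √ε₀ C'₀` and `‖F − 𝔼_{b_x(R+ℓ)ᶜ}(F)‖ ≤ √ε₀ C'_p/(ℓ+1)^p`.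
[folklore] -/
theorem sqrt_tail_bounds (x : TorusSite d L) (R : ℕ) {F : Op (TorusSite d L × κ) q} {ε₀ : ℝ}
    (hε0 : 0 ≤ ε₀) (hε1 : ε₀ ≤ 1) {C : ℕ → ℝ} (hC : ∀ p, 0 ≤ C p) (hF0 : ‖F‖ ≤ ε₀ * C 0)
    (htail : ∀ ℓ p : ℕ, ‖F - twirl (cellBall x (R + ℓ) : Finset (TorusSite d L × κ))ᶜ F‖ ≤
      C p / ((ℓ : ℝ) + 1) ^ p) :
    ‖F‖ ≤ Real.sqrt ε₀ * (C 0 + Real.sqrt (2 * C 0 * C (2 * 0))) ∧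
    ∀ ℓ p : ℕ, ‖F - twirl (cellBall x (R + ℓ) : Finset (TorusSite d L × κ))ᶜ F‖ ≤
      Real.sqrt ε₀ * ((C 0 + Real.sqrt (2 * C 0 * C (2 * p))) / ((ℓ : ℝ) + 1) ^ p) := by
  have hsq : ε₀ ≤ Real.sqrt ε₀ := by
    have h1 : ε₀ * ε₀ ≤ ε₀ := mul_le_of_le_one_left hε0 hε1
    calc ε₀ = Real.sqrt (ε₀ * ε₀) := (Real.sqrt_mul_self hε0).symm
      _ ≤ Real.sqrt ε₀ := Real.sqrt_le_sqrt h1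
  have hs0 : 0 ≤ Real.sqrt ε₀ := Real.sqrt_nonneg _
  refine ⟨?_, fun ℓ p => ?_⟩
  · calc ‖F‖ ≤ ε₀ * C 0 := hF0
      _ ≤ Real.sqrt ε₀ * C 0 := mul_le_mul_of_nonneg_right hsq (hC 0)
      _ ≤ Real.sqrt ε₀ * (C 0 + Real.sqrt (2 * C 0 * C (2 * 0))) :=
          mul_le_mul_of_nonneg_left (le_add_of_nonneg_right (Real.sqrt_nonneg _)) hs0
  · set e : ℝ := ‖F - twirl (cellBall x (R + ℓ) : Finset (TorusSite d L × κ))ᶜ F‖ with he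
    have hℓ1 : (0 : ℝ) < (ℓ : ℝ) + 1 := by positivity
    have he0 : 0 ≤ e := norm_nonneg _
    have hea : e ≤ 2 * ε₀ * C 0 := by
      calc e ≤ ‖F‖ + ‖twirl (cellBall x (R + ℓ) : Finset (TorusSite d L × κ))ᶜ F‖ := norm_sub_le _ _
        _ ≤ ‖F‖ + ‖F‖ := add_le_add le_rfl (norm_twirl_le _ F)
        _ ≤ 2 * ε₀ * C 0 := by linarith
    have heb : e ≤ C (2 * p) / ((ℓ : ℝ) + 1) ^ (2 * p) := htail ℓ (2 * p)
    have h1 := le_sqrt_mul_of_le_of_le he0 hea heb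
    have h2 : Real.sqrt (2 * ε₀ * C 0 * (C (2 * p) / ((ℓ : ℝ) + 1) ^ (2 * p))) =
        Real.sqrt ε₀ * (Real.sqrt (2 * C 0 * C (2 * p)) / ((ℓ : ℝ) + 1) ^ p) := by
      have e1 : 2 * ε₀ * C 0 * (C (2 * p) / ((ℓ : ℝ) + 1) ^ (2 * p)) =
          ε₀ * ((2 * C 0 * C (2 * p)) / ((ℓ : ℝ) + 1) ^ (2 * p)) := by ring
      rw [e1, Real.sqrt_mul hε0, sqrt_div_pow_two_mul (by have := hC 0; have := hC (2 * p); positivity)]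
    rw [h2] at h1
    refine h1.trans (mul_le_mul_of_nonneg_left ?_ hs0)
    exact div_le_div_of_nonneg_right (le_add_of_nonneg_left (hC 0)) (by positivity)

end Helpers

/-! ### The reduction -/

section Core

universe u

variable (d q : ℕ) {κ : Type u} [Fintype κ] [DecidableEq κ]

/-- **`michalakis_zwolak` from an `O(ε)` norm estimate and `ε`-free tail estimates (MZ13 Lemma
1 (iv),(v) + Lemma 2).** See the module docstring for the remaining hypothesis `hT`.
[cite: MichalakisZwolakCMP2013, Thm. 1, §5.1–5.2 (arXiv:1109.1588 pp. 6–12)] -/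
theorem michalakis_zwolak_of_tail_core
    (hT : ∀ (Φ : (L : ℕ) → Interaction (TorusSite d L × κ) q) (m : ℕ → ℕ) (γ : ℝ) (r₀ : ℕ)
      (Δ γloc : ℕ → ℝ),
      (∀ (L : ℕ) [NeZero L], IsProjectorInteraction (Φ L) ∧ (Φ L).IsLocal) →
      (∀ (L : ℕ) [NeZero L], IsFrustrationFree (Φ L) univ) →
      (∀ (L : ℕ) [NeZero L] (X : Finset (TorusSite d L × κ)), r₀ < torusDiam X → Φ L X = 0) →
      (0 < γ ∧ ∀ (L : ℕ) [NeZero L], (localHamiltonian (Φ L) univ).HasClusterGap (m L) 0 γ) →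
      HasUniformLTQO Φ Δ → HasFastDecay Δ → HasUniformLocalGap Φ γloc →
      (∃ c : ℝ, ∃ p : ℕ, 0 < c ∧ ∀ ℓ : ℕ, c / ((ℓ : ℝ) + 1) ^ p ≤ γloc ℓ) →
      ∀ (r : ℕ) (V : (L : ℕ) → Interaction (TorusSite d L × κ) q),
        (∀ (L : ℕ) [NeZero L], (V L).IsLocal ∧
          (∀ X, r < torusDiam X → V L X = 0) ∧ ∀ X, ‖V L X‖ ≤ 1) →
        ∀ w : 𝓢(ℝ, ℂ), (∫ t : ℝ, w t) = 1 →
          (∀ D : ℝ, γ / 2 ≤ |D| → ∫ t : ℝ, cexp (t * D * I) * w t = 0) →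
          (∀ t : ℝ, starRingEnd ℂ (w t) = w t) →
        ∀ W : ℝ → ℂ, AEStronglyMeasurable W volume →
          (∀ k : ℕ, ∃ M : ℝ, ∀ t : ℝ, |t| ^ k * ‖W t‖ ≤ M) →
          (∀ k : ℕ, Integrable fun t : ℝ => ‖t‖ ^ k * ‖W t‖) → Integrable W →
          (∀ D : ℝ, γ / 4 ≤ |D| → ∫ t : ℝ, cexp (t * D * I) * W t = I / D) →
          (∀ t : ℝ, starRingEnd ℂ (W t) = W t) →
        ∃ L_A : ℕ, ∃ C : ℕ → ℝ, (∀ p, 0 ≤ C p) ∧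
          ∀ ε : ℝ, |ε| ≤ 1 → ∀ (L : ℕ) [NeZero L], L_A ≤ L → ∀ s ∈ Set.Icc (0 : ℝ) 1,
            (∀ t ∈ Set.Icc (0 : ℝ) s, ∃ ω : ℝ, ω ≤ γ ∧
              (localHamiltonian (Φ L) univ +
                (t : ℂ) • ((ε : ℂ) • localHamiltonian (V L) univ)).HasClusterGap (m L) ω (γ / 2)) →
            ∀ U : ℝ → Op (TorusSite d L × κ) q, U 0 = 1 →
              (∀ t ∈ Set.Icc (0 : ℝ) s, HasDerivWithinAt U
                (((Complex.I : ℂ) • ∫ τ : ℝ, W τ • heisenbergEvolution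
                    (∑ Z, Φ L Z + t • ((ε : ℂ) • ∑ Z, V L Z)) τ ((ε : ℂ) • ∑ Z, V L Z)) * U t)
                (Set.Icc 0 s) t) →
              (∀ t ∈ Set.Icc (0 : ℝ) s, (U t)ᴴ * U t = 1) →
              (∀ t ∈ Set.Icc (0 : ℝ) s, U t * (U t)ᴴ = 1) →
              (∀ (Z : Finset (TorusSite d L × κ)) (x : TorusSite d L), Φ L Z ≠ 0 →
                Z ⊆ cellBall x r₀ →
                ‖star (U s) * (∫ t : ℝ, w t • heisenbergEvolution
                    (∑ Z, Φ L Z + s • ((ε : ℂ) • ∑ Z, V L Z)) t (Φ L Z)) * U s -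
                    ∫ t : ℝ, w t • heisenbergEvolution (∑ Z, Φ L Z) t (Φ L Z)‖ ≤ |ε| * C 0 ∧
                ∀ ℓ p : ℕ, ‖(star (U s) * (∫ t : ℝ, w t • heisenbergEvolution
                    (∑ Z, Φ L Z + s • ((ε : ℂ) • ∑ Z, V L Z)) t (Φ L Z)) * U s -
                    ∫ t : ℝ, w t • heisenbergEvolution (∑ Z, Φ L Z) t (Φ L Z)) -
                  twirl (cellBall x (r₀ + ℓ) : Finset (TorusSite d L × κ))ᶜ
                    (star (U s) * (∫ t : ℝ, w t • heisenbergEvolution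
                      (∑ Z, Φ L Z + s • ((ε : ℂ) • ∑ Z, V L Z)) t (Φ L Z)) * U s -
                      ∫ t : ℝ, w t • heisenbergEvolution (∑ Z, Φ L Z) t (Φ L Z))‖ ≤
                  C p / ((ℓ : ℝ) + 1) ^ p) ∧
              (∀ (Z : Finset (TorusSite d L × κ)) (x : TorusSite d L), V L Z ≠ 0 →
                Z ⊆ cellBall x r →
                ∀ ℓ p : ℕ, ‖star (U s) * (∫ t : ℝ, w t • heisenbergEvolution
                    (∑ Z, Φ L Z + s • ((ε : ℂ) • ∑ Z, V L Z)) t (V L Z)) * U s -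
                  twirl (cellBall x (r + ℓ) : Finset (TorusSite d L × κ))ᶜ
                    (star (U s) * (∫ t : ℝ, w t • heisenbergEvolution
                      (∑ Z, Φ L Z + s • ((ε : ℂ) • ∑ Z, V L Z)) t (V L Z)) * U s)‖ ≤
                  C p / ((ℓ : ℝ) + 1) ^ p)) :
    michalakis_zwolak (κ := κ) d q := by
  classical
  refine michalakis_zwolak_of_locality_core_sqrt d q ?_
  intro Φ m γ r₀ Δ γloc hproj hff hrange hgap hltqo hΔ hloc hγloc r V hV w hw1 hw2 hw3
    W hWm hWmom hWmomi hWi hW hWr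
  obtain ⟨L_A, C, hC0, hcore⟩ := hT Φ m γ r₀ Δ γloc hproj hff hrange hgap hltqo hΔ hloc hγloc r V hV
    w hw1 hw2 hw3 W hWm hWmom hWmomi hWi hW hWr
  have hwi : Integrable (fun t : ℝ => w t) := w.integrable
  set Nw : ℝ := ∫ t : ℝ, ‖w t‖ with hNw
  have hNw0 : 0 ≤ Nw := integral_nonneg fun t => norm_nonneg _
  -- the `√ε` envelope of the `Φ`-terms and the plain envelope of the `V`-terms
  set C' : ℕ → ℝ := fun p => C 0 + Real.sqrt (2 * C 0 * C (2 * p)) with hC'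
  have hC'0 : ∀ p, 0 ≤ C' p := fun p => add_nonneg (hC0 0) (Real.sqrt_nonneg _)
  refine ⟨L_A, fun p => (C' 0 * ((r₀ : ℝ) + 1) ^ p + 2 * C' p * ((r₀ : ℝ) + 2) ^ p) +
    ((C 0 + Nw) * ((r : ℝ) + 1) ^ p + 2 * (C p + Nw) * ((r : ℝ) + 2) ^ p), ?_⟩
  intro ε hε L _ hL1 s hs hprev U hU0 hUd hU1 hU2
  obtain ⟨hA, hB⟩ := hcore ε hε L hL1 s hs hprev U hU0 hUd hU1 hU2
  have hBdA : ∀ p, 0 ≤ C' 0 * ((r₀ : ℝ) + 1) ^ p + 2 * C' p * ((r₀ : ℝ) + 2) ^ p := fun p => by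
    have := hC'0 0; have := hC'0 p; positivity
  have hBdB : ∀ p, 0 ≤ (C 0 + Nw) * ((r : ℝ) + 1) ^ p + 2 * (C p + Nw) * ((r : ℝ) + 2) ^ p :=
    fun p => by have := hC0 0; have := hC0 p; positivity
  have hη0 : 0 ≤ Real.sqrt |ε| := Real.sqrt_nonneg _
  -- Hamiltonians, hermiticity, the unitary
  set H₀' : Op (TorusSite d L × κ) q := ∑ Z, Φ L Z with hH₀'def
  set Hs : Op (TorusSite d L × κ) q := ∑ Z, Φ L Z + s • ((ε : ℂ) • ∑ Z, V L Z) with hHsdef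
  have hH₀'h : H₀'.IsHermitian := by
    rw [hH₀'def, ← localHamiltonian_univ_eq_sum]; exact localHamiltonian_isHermitian (hproj L).2 univ
  have hV₁h : (∑ Z, V L Z).IsHermitian := by
    rw [← localHamiltonian_univ_eq_sum]; exact localHamiltonian_isHermitian (hV L).1 univ
  have hHsh : Hs.IsHermitian :=
    hH₀'h.add (((isHermitian_ofReal_smul hV₁h ε)).smul (IsSelfAdjoint.all s))
  have hsmem : s ∈ Set.Icc (0 : ℝ) s := ⟨hs.1, le_rfl⟩
  have hUs : U s ∈ unitary (Op (TorusSite d L × κ) q) := by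
    rw [Unitary.mem_iff, star_eq_conjTranspose]; exact ⟨hU1 s hsmem, hU2 s hsmem⟩
  -- the two families of observables
  set FA : Finset (TorusSite d L × κ) → Op (TorusSite d L × κ) q := fun Z =>
    star (U s) * (∫ t : ℝ, w t • heisenbergEvolution Hs t (Φ L Z)) * U s -
      ∫ t : ℝ, w t • heisenbergEvolution H₀' t (Φ L Z) with hFAdef
  set FB : Finset (TorusSite d L × κ) → Op (TorusSite d L × κ) q := fun Z =>
    star (U s) * (∫ t : ℝ, w t • heisenbergEvolution Hs t (V L Z)) * U s with hFBdef
  have hFAh : ∀ Z, (FA Z).IsHermitian := fun Z =>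
    (isHermitian_star_mul_mul (isHermitian_integral_smul_heisenbergEvolution hHsh
      ((hproj L).2.isHermitian Z) hwi hw3)).sub
      (isHermitian_integral_smul_heisenbergEvolution hH₀'h ((hproj L).2.isHermitian Z) hwi hw3)
  have hFBh : ∀ Z, (FB Z).IsHermitian := fun Z =>
    isHermitian_star_mul_mul (isHermitian_integral_smul_heisenbergEvolution hHsh
      ((hV L).1.isHermitian Z) hwi hw3)
  have hFBn : ∀ Z, ‖FB Z‖ ≤ Nw := fun Z =>
    calc ‖FB Z‖ ≤ ‖∫ t : ℝ, w t • heisenbergEvolution Hs t (V L Z)‖ :=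
          norm_star_mul_mul_le_of_mem_unitary hUs _
      _ ≤ Nw * ‖V L Z‖ := norm_integral_smul_heisenbergEvolution_le hHsh _ _
      _ ≤ Nw * 1 := mul_le_mul_of_nonneg_left ((hV L).2.2 Z) hNw0
      _ = Nw := mul_one _
  -- centres
  set x₀ : TorusSite d L := fun _ => 0 with hx₀
  set c : Finset (TorusSite d L × κ) → TorusSite d L :=
    fun Z => if h : Z.Nonempty then h.choose.1 else x₀ with hcdef
  have hcsub : ∀ (Z : Finset (TorusSite d L × κ)) (R : ℕ), torusDiam Z ≤ R → Z ⊆ cellBall (c Z) R := by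
    intro Z R hR
    by_cases h : Z.Nonempty
    · have hc : c Z = h.choose.1 := by simp only [hcdef, dif_pos h]
      rw [hc]; exact subset_cellBall_of_mem_of_torusDiam_le h.choose_spec hR
    · rw [Finset.not_nonempty_iff_eq_empty.mp h]; exact Finset.empty_subset _
  have hcΦ : ∀ Z, Φ L Z ≠ 0 → Z ⊆ cellBall (c Z) r₀ := fun Z hZ =>
    hcsub Z r₀ (not_lt.mp fun h => hZ (hrange L Z h))
  have hcV : ∀ Z, V L Z ≠ 0 → Z ⊆ cellBall (c Z) r := fun Z hZ =>
    hcsub Z r (not_lt.mp fun h => hZ ((hV L).2.1 Z h))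
  -- pieces of the `Φ`-terms (the `√ε` trick)
  have hexA : ∀ Z, ∃ A : ℕ → Op (TorusSite d L × κ) q,
      (Φ L Z ≠ 0 → ∑ i ∈ range (L + 1), A i = FA Z) ∧ (∀ i, (A i).IsHermitian) ∧
      (∀ i, IsSupportedOn (A i) (cellBall (c Z) i)) ∧
      ∀ i p : ℕ, ‖A i‖ ≤ Real.sqrt |ε| * ((C' 0 * ((r₀ : ℝ) + 1) ^ p + 2 * C' p * ((r₀ : ℝ) + 2) ^ p) /
        ((i : ℝ) + 1) ^ p) := by
    intro Z
    by_cases hZ : Φ L Z = 0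
    · refine ⟨fun _ => 0, fun h => absurd hZ h, fun _ => isHermitian_zero,
        fun _ => IsSupportedOn.zero _, fun i p => ?_⟩
      rw [norm_zero]; exact mul_nonneg hη0 (div_nonneg (hBdA p) (by positivity))
    · obtain ⟨hn, ht⟩ := hA Z (c Z) hZ (hcΦ Z hZ)
      obtain ⟨hn', ht'⟩ := sqrt_tail_bounds (c Z) r₀ (abs_nonneg ε) hε hC0 hn ht
      obtain ⟨A, hsum, hh, hsupp, hbd⟩ := exists_ball_pieces_of_pow_tails (c Z) r₀ (hFAh Z)
        hη0 hC'0 hn' ht'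
      exact ⟨A, fun _ => hsum, hh, hsupp, hbd⟩
  choose A hAsum hAh hAs hAn using hexA
  -- pieces of the `V`-terms
  have hexB : ∀ Z, ∃ B : ℕ → Op (TorusSite d L × κ) q,
      (V L Z ≠ 0 → ∑ i ∈ range (L + 1), B i = FB Z) ∧ (∀ i, (B i).IsHermitian) ∧
      (∀ i, IsSupportedOn (B i) (cellBall (c Z) i)) ∧
      ∀ i p : ℕ, ‖B i‖ ≤ 1 * (((C 0 + Nw) * ((r : ℝ) + 1) ^ p + 2 * (C p + Nw) * ((r : ℝ) + 2) ^ p) /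
        ((i : ℝ) + 1) ^ p) := by
    intro Z
    by_cases hZ : V L Z = 0
    · refine ⟨fun _ => 0, fun h => absurd hZ h, fun _ => isHermitian_zero,
        fun _ => IsSupportedOn.zero _, fun i p => ?_⟩
      rw [norm_zero, one_mul]; exact div_nonneg (hBdB p) (by positivity)
    · have ht := hB Z (c Z) hZ (hcV Z hZ)
      have hC'' : ∀ p, 0 ≤ C p + Nw := fun p => add_nonneg (hC0 p) hNw0
      have hn : ‖FB Z‖ ≤ 1 * (C 0 + Nw) := by
        rw [one_mul]; exact (hFBn Z).trans (le_add_of_nonneg_left (hC0 0))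
      have ht' : ∀ ℓ p : ℕ, ‖FB Z - twirl (cellBall (c Z) (r + ℓ) : Finset (TorusSite d L × κ))ᶜ
          (FB Z)‖ ≤ 1 * ((C p + Nw) / ((ℓ : ℝ) + 1) ^ p) := by
        intro ℓ p
        rw [one_mul]
        exact (ht ℓ p).trans (div_le_div_of_nonneg_right (le_add_of_nonneg_right hNw0)
          (by positivity))
      obtain ⟨B, hsum, hh, hsupp, hbd⟩ := exists_ball_pieces_of_pow_tails (c Z) r (hFBh Z)
        zero_le_one hC'' hn ht'
      exact ⟨B, fun _ => hsum, hh, hsupp, hbd⟩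
  choose B hBsum hBh hBs hBn using hexB
  refine ⟨c, c, A, B, hcΦ, hcV, fun Z hZ => hAsum Z hZ, fun Z hZ => hBsum Z hZ, hAs, hBs, hAh, hBh,
    fun Z i p => ?_, fun Z i p => ?_⟩
  · -- envelope comparison, `A`-part
    exact (hAn Z i p).trans (mul_le_mul_of_nonneg_left (div_le_div_of_nonneg_right
      (le_add_of_nonneg_right (hBdB p)) (by positivity)) hη0)
  · -- envelope comparison, `B`-part
    refine (hBn Z i p).trans ?_
    rw [one_mul]
    exact div_le_div_of_nonneg_right (le_add_of_nonneg_left (hBdA p)) (by positivity)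

end Core

end Literature.MathematicalPhysics.QuantumLattice
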